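import Summits.QuantumFields.YangMills.Cruxes.CompleteAnalyticityAtLargeScales.StrategistCensus
import Summits.QuantumFields.YangMills.Theorems.OneCertifiedCubeFiniteSizeCriterion

/-!
# Strategist census r1 (REDIRECT, second opinion) for crux `CertificationLength.CompleteAnalyticityAtLargeScales`
# (stmt-QuantumFields-16178) — typed objects

Companion of `STRATEGY-CENSUS.md` (revision r1, unit `cstrat-stmt-QuantumFields-16178-r1`) and of the first census
`StrategistCensus.lean` (unit `cstrat-…-b1`), whose objects (`TVFiniteSize`, `SeparatingData`,
`ForcedDefectSeparation` (H), `CompleteAnalyticityAtLargeScalesSC` (A_SC), `UniformLatticeGapSC`, …) are IMPORTED,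
not re-declared.  Everything below is sorry-free; nothing is a proof of the crux or of its negation.  New in r1:

* §1 `crux_iff_sc_and_nsc` — the crux (A) is EXACTLY `A_SC ∧ A_NSC` (classical case split on
  `SimplyConnectedSpace G`), and `not_nsc_of_forcedDefectSeparation : H → ¬ A_NSC`.  This is the only two-piece
  split of (A) with a proved assembly in which one piece is plannable; the other piece is refuted modulo H (the
  forced `π₁(G)`-monopole world-line for `SO(3)`), so no `route edit --split` is filed: an admissible decomposition
  needs EVERY open piece honest and planned.
* §2 `uniformLatticeGapSC_of_cruxSC : A_SC → UniformLatticeGapSC` — the landed funnel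
  `uniformLatticeGap_of_completeAnalyticityAtLargeScales` is `G`-local because the tree's PROVED
  `FiniteSizeCriterion_proof` (stmt-8895) is quantified per group and representation; hence even the REPAIRED crux is
  at least the volume-uniform weak-coupling lattice mass gap for every simply connected compact simple `G`
  (stmt-8778 restricted to `π₁ = 0`, the declared open lattice core of the summit).  The first census had this only
  from the unrepaired crux (`uniformLatticeGapSC_of_crux`).
* §3 `ScaleMonotonicity` (typed; provable-grade Dobrushin–Shlosman / Martinelli–Olivieri bookkeeping over the tree's
  `recursion_decay` + `multiCell_influence_general` engine) and `CertifiedAtSomeScaleSC` (line `birth`'s B-free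
  Stub 1 restricted to simply connected `G`), with the glued split
  `cruxSC_of_someScale_of_monotone : CertifiedAtSomeScaleSC → ScaleMonotonicity → A_SC` (PROVED) and the
  calibration `uniformLatticeGapSC_of_someScaleSC : CertifiedAtSomeScaleSC → UniformLatticeGapSC` (PROVED): the
  `∀ B` quantifier of the crux ("the certification LENGTH diverges") is bookkeeping once monotonicity in the scale is
  available; the whole difficulty is complete analyticity at SOME scale at every large `β`, and that piece alone is
  already ≥ the lattice gap.
* §4 the same split for the crux AS TYPED, `crux_of_someScale_of_monotone : CertifiedAtSomeScale →
  ScaleMonotonicity → (A)` (PROVED; `CertifiedAtSomeScale` is `Birth.stub_certifiedAtSomeScale`'s statement, named),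
  and `not_certifiedAtSomeScale_of_forcedDefectSeparation : H → ¬ CertifiedAtSomeScale`: H refutes line `birth`'s
  Stub 1 as well (a separating datum at EVERY `b ≥ 1`), so no re-cut of (A) that keeps the `π₁ ≠ 0` sector in a
  constructive piece is honest.

References: R. L. Dobrushin, S. B. Shlosman, *Completely analytical interactions: constructive description*,
J. Stat. Phys. 46 (1987) 983–1014, §2 (conditions I–III and their equivalence for finite spin spaces);
F. Martinelli, E. Olivieri, *Approach to equilibrium of Glauber dynamics in the one phase region I*, CMP 161 (1994)
447–486, §2 (strong mixing for regular volumes ⇒ finite-size conditions at larger multiples of the basic scale);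
G. Mack, V. B. Petkova, *Comparison of lattice gauge theories with gauge groups Z₂ and SU(2)*, Ann. Phys. 123 (1979)
442 (ℤ₂ monopoles / vortices of `SO(3) = SU(2)/ℤ₂` lattice theory).
-/

set_option autoImplicit false

noncomputable section

open MeasureTheory
open Literature.MathematicalPhysics.QuantumFieldTheory hiding Site ZdEdge
open Literature.MathematicalPhysics.QuantumLattice

namespace Summit.QuantumFields.YangMills.Cruxes.CompleteAnalyticityAtLargeScales.Strategist

/-! ### §1. The sector split of the crux as typed, and why it is not filed -/

/-- **(A_NSC)** — the crux restricted to the `π₁(G) ≠ 0` sector (binder `¬ SimplyConnectedSpace G →` added).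
Physics-grade FALSE already for `(SO(3), defining representation)`: `not_nsc_of_forcedDefectSeparation`. [folklore] -/
def CompleteAnalyticityAtLargeScalesNSC : Prop :=
  ∀ (G : Type) [Group G] [TopologicalSpace G] [IsTopologicalGroup G] [CompactSpace G],
    IsCompactSimpleLieGroup G → ¬ SimplyConnectedSpace G →
    letI : MeasurableSpace G := borel G; haveI : BorelSpace G := ⟨rfl⟩;
    ∀ r : LatticeRep G, ∃ (n : ℕ) (ε : ℝ), 1 ≤ n ∧ 0 ≤ ε ∧
      ε * ((((4 * n + 3) ^ 4 - (4 * n + 1) ^ 4 : ℕ)) : ℝ) < 1 ∧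
      ∀ B : ℕ, ∃ β₂ : ℝ, ∀ β : ℝ, β₂ ≤ β → ∃ b : ℕ, B ≤ b ∧ 1 ≤ b ∧ TVFiniteSize r.ρ β b n ε

/-- The crux as typed implies its `π₁ ≠ 0` sector. [folklore] -/
theorem nsc_of_crux
    (h : Summit.QuantumFields.YangMills.Theses.CertificationLength.CompleteAnalyticityAtLargeScales) :
    CompleteAnalyticityAtLargeScalesNSC :=
  fun G _ _ _ _ hG _ => h G hG

/-- **The crux is exactly the conjunction of its two sectors** (`Classical.em (SimplyConnectedSpace G)`): the
assembly of the sector split is one line, and it is the ONLY content-free step available — see §3 for the other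
proved split. [folklore] -/
theorem crux_iff_sc_and_nsc :
    Summit.QuantumFields.YangMills.Theses.CertificationLength.CompleteAnalyticityAtLargeScales ↔
    (CompleteAnalyticityAtLargeScalesSC ∧ CompleteAnalyticityAtLargeScalesNSC) := by
  refine ⟨fun h => ⟨sc_of_crux h, nsc_of_crux h⟩, ?_⟩
  rintro ⟨hsc, hnsc⟩ G _ _ _ _ hG
  by_cases hπ : SimplyConnectedSpace G
  · exact hsc G hG hπ
  · exact hnsc G hG hπ

/-- **H refutes the `π₁ ≠ 0` piece** (same bookkeeping as `completeAnalyticityAtLargeScales_false_of_…`, now aimed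
at the sector that H actually inhabits): the sector split has a refuted-modulo-H piece, hence is not an admissible
decomposition of the crux. [folklore] -/
theorem not_nsc_of_forcedDefectSeparation (h : ForcedDefectSeparation) :
    ¬ CompleteAnalyticityAtLargeScalesNSC := by
  intro hA
  obtain ⟨G, _, _, _, _, hG, hπ, hsep⟩ := h
  letI : MeasurableSpace G := borel G
  haveI : BorelSpace G := ⟨rfl⟩
  obtain ⟨r, hr⟩ := hsep
  obtain ⟨n, ε, hn, hε, hM, hB⟩ := hA G hG hπ r
  obtain ⟨β₀, hβ₀⟩ := hr n hn
  obtain ⟨β₂, hβ₂⟩ := hB 1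
  obtain ⟨b, -, hb1, hFS⟩ := hβ₂ (max β₀ β₂) (le_max_right _ _)
  exact not_tvFiniteSize_of_separatingData r.ρ (max β₀ β₂) b n (eps_lt_half hε hM)
    (hβ₀ (max β₀ β₂) (le_max_left _ _) b hb1) hFS

/-- Conversely the crux as typed is recovered from H's failure sector-by-sector: `A_SC → (¬ H-sector holds) → …` is
NOT available — `¬ A_NSC` does not follow from anything in the tree; what the tree has is only the one-way street
`H → ¬ A_NSC → ¬ (A)`. Recorded as the composite. [folklore] -/
theorem crux_false_of_forcedDefectSeparation' (h : ForcedDefectSeparation) :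
    ¬ Summit.QuantumFields.YangMills.Theses.CertificationLength.CompleteAnalyticityAtLargeScales :=
  fun hA => not_nsc_of_forcedDefectSeparation h (nsc_of_crux hA)

/-! ### §2. Calibration of the REPAIRED crux: `A_SC → UniformLatticeGapSC` (the funnel is `G`-local) -/

/-- **`A_SC` ⇒ the weak-coupling uniform lattice mass gap for every simply connected compact simple `G`.**
Per-`G` rerun of `uniformLatticeGap_of_cellAnalyticity_of_criterion` with the criterion discharged by the tree's
PROVED `FiniteSizeCriterion_proof` (stmt-8895, quantified per `(G, ρ)`): `B = 1`, rate `κ(n,ε)/b`, threshold side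
`(8n+7) b`.  So restating the crux to its simply-connected repair does not lower it below stmt-8778-SC. [folklore] -/
theorem uniformLatticeGapSC_of_cruxSC (h : CompleteAnalyticityAtLargeScalesSC) : UniformLatticeGapSC := by
  intro G _ _ _ _ hG hSC
  letI : MeasurableSpace G := borel G
  haveI : BorelSpace G := ⟨rfl⟩
  intro r
  obtain ⟨n, ε, hn, hε, hεM, hB⟩ := h G hG hSC r
  obtain ⟨β₂, hβ₂⟩ := hB 1
  refine ⟨β₂, fun β hβ => ?_⟩
  obtain ⟨b, -, hb1, hTV⟩ := hβ₂ β hβ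
  obtain ⟨κ, hκ, hAll⟩ := Summit.QuantumFields.YangMills.Theorems.FiniteSizeCriterion_proof n ε hn hε hεM
  have hb0 : (0 : ℝ) < (b : ℝ) := by exact_mod_cast hb1
  refine ⟨κ / b, div_pos hκ hb0, (8 * n + 7) * b, fun A B => ?_⟩
  obtain ⟨C, hC⟩ := hAll G r.N r.ρ r.continuous r.injective A B
  refine ⟨C, fun S t hS ht => ?_⟩
  have h2S : (8 * n + 7) * b ≤ 2 * S + 1 := by omega
  have h := hC β b hb1 hTV S h2S t ht
  rw [div_mul_eq_mul_div]
  exact h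

/-! ### §3. The scale-bookkeeping split of the repaired crux: (some scale) ∧ (monotonicity in the scale) ⇒ A_SC -/

/-- **`ScaleMonotonicity`** — the TV finite-size condition propagates UP in the scale with a universal change of
window: for every admissible `(n, ε)` there is an admissible `(n', ε')` such that for every compact `G`, continuous
faithful `ρ`, every `β` and every `b ≥ 1`, `FS(ρ, β, b, n, ε)` implies `FS(ρ, β, b', n', ε')` for all `b'` beyond
some `b₀` (in fact `b₀ = k(n,ε)·b`).  Provable-grade: `FS(b,n,ε)` ⇒ TV strong mixing on `b`-regular cell unions at
rate `κ(n,ε)/b` with universal constants (the tree's `recursion_decay` / `box_influence_le` engine,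
`Ψ(N) ≤ (ε M(n))^{⌊N/(2n+1)⌋}`), every `[b',2b']`-frame with `b' ≥ b` refines to a `[b,2b]`-frame, and the influence
of exterior changes beyond `Q_{n'}` (in `b'`-cells) on the central `b'`-cell is `≤ poly(b'/b, n') e^{-2κ n' b'/b}`,
which is `≤ ε'` with `ε' M(n') < 1` for `n'` large depending on `κ` only.  [cite: DobrushinShlosman1987, §2;
Martinelli–Olivieri 1994, §2] Not in the tree; typed here as the provable half of the split. [folklore] -/
def ScaleMonotonicity : Prop :=
  ∀ (n : ℕ) (ε : ℝ), 1 ≤ n → 0 ≤ ε → ε * ((((4 * n + 3) ^ 4 - (4 * n + 1) ^ 4 : ℕ)) : ℝ) < 1 →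
    ∃ (n' : ℕ) (ε' : ℝ), 1 ≤ n' ∧ 0 ≤ ε' ∧ ε' * ((((4 * n' + 3) ^ 4 - (4 * n' + 1) ^ 4 : ℕ)) : ℝ) < 1 ∧
      ∀ (G : Type) [Group G] [TopologicalSpace G] [IsTopologicalGroup G] [CompactSpace G]
        [MeasurableSpace G] [BorelSpace G] (N : ℕ) (ρ : G →* Matrix (Fin N) (Fin N) ℂ),
        Continuous ρ → Function.Injective ρ →
        ∀ (β : ℝ) (b : ℕ), 1 ≤ b → TVFiniteSize ρ β b n ε →
          ∃ b₀ : ℕ, ∀ b' : ℕ, b₀ ≤ b' → TVFiniteSize ρ β b' n' ε'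

/-- **`CertifiedAtSomeScaleSC`** — line `birth`'s Stub 1 (`CertifiedAtSomeScale`: at every large `β` SOME cell
size `b ≥ 1` is certified) restricted to simply connected `G`: the crux's repair with the clause `B ≤ b` removed.
This is where the whole difficulty of A_SC lives (§3 calibration: it alone is ≥ `UniformLatticeGapSC`). [folklore] -/
def CertifiedAtSomeScaleSC : Prop :=
  ∀ (G : Type) [Group G] [TopologicalSpace G] [IsTopologicalGroup G] [CompactSpace G],
    IsCompactSimpleLieGroup G → SimplyConnectedSpace G →
    letI : MeasurableSpace G := borel G; haveI : BorelSpace G := ⟨rfl⟩;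
    ∀ r : LatticeRep G, ∃ (n : ℕ) (ε : ℝ), 1 ≤ n ∧ 0 ≤ ε ∧
      ε * ((((4 * n + 3) ^ 4 - (4 * n + 1) ^ 4 : ℕ)) : ℝ) < 1 ∧
      ∃ β₁ : ℝ, ∀ β : ℝ, β₁ ≤ β → ∃ b : ℕ, 1 ≤ b ∧ TVFiniteSize r.ρ β b n ε

/-- **The scale-bookkeeping split, glued (sorry-free): `CertifiedAtSomeScaleSC → ScaleMonotonicity → A_SC`.**
`(n, ε, β₁)` from the first piece, `(n', ε')` from monotonicity (universal in `β`, which is what the quantifier order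
of the crux — `(n, ε)` before `B` and `β` — requires); at `β ≥ β₁` the certified `b` is pushed to `max b₀ B`. [folklore] -/
theorem cruxSC_of_someScale_of_monotone (h₁ : CertifiedAtSomeScaleSC) (h₂ : ScaleMonotonicity) :
    CompleteAnalyticityAtLargeScalesSC := by
  intro G _ _ _ _ hG hSC
  letI : MeasurableSpace G := borel G
  haveI : BorelSpace G := ⟨rfl⟩
  intro r
  obtain ⟨n, ε, hn, hε, hM, β₁, hcert⟩ := h₁ G hG hSC r
  obtain ⟨n', ε', hn', hε', hM', hmono⟩ := h₂ n ε hn hε hM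
  refine ⟨n', ε', hn', hε', hM', fun B => ⟨β₁, fun β hβ => ?_⟩⟩
  obtain ⟨b, hb1, hFS⟩ := hcert β hβ
  obtain ⟨b₀, hb₀⟩ := hmono G r.N r.ρ r.continuous r.injective β b hb1 hFS
  refine ⟨max b₀ (max B 1), le_trans (le_max_left _ _) (le_max_right _ _),
    le_trans (le_max_right _ _) (le_max_right _ _), hb₀ _ (le_max_left _ _)⟩

/-- **Calibration of the hard piece: `CertifiedAtSomeScaleSC → UniformLatticeGapSC`** (the funnel needs only
`B = 1`, i.e. SOME certified scale): the B-free core of the repaired crux is already at least the weak-coupling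
uniform lattice mass gap for simply connected `G` — the summit's declared open lattice core. [folklore] -/
theorem uniformLatticeGapSC_of_someScaleSC (h : CertifiedAtSomeScaleSC) : UniformLatticeGapSC := by
  intro G _ _ _ _ hG hSC
  letI : MeasurableSpace G := borel G
  haveI : BorelSpace G := ⟨rfl⟩
  intro r
  obtain ⟨n, ε, hn, hε, hεM, β₁, hcert⟩ := h G hG hSC r
  refine ⟨β₁, fun β hβ => ?_⟩
  obtain ⟨b, hb1, hTV⟩ := hcert β hβ
  obtain ⟨κ, hκ, hAll⟩ := Summit.QuantumFields.YangMills.Theorems.FiniteSizeCriterion_proof n ε hn hε hεM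
  have hb0 : (0 : ℝ) < (b : ℝ) := by exact_mod_cast hb1
  refine ⟨κ / b, div_pos hκ hb0, (8 * n + 7) * b, fun A B => ?_⟩
  obtain ⟨C, hC⟩ := hAll G r.N r.ρ r.continuous r.injective A B
  refine ⟨C, fun S t hS ht => ?_⟩
  have h2S : (8 * n + 7) * b ≤ 2 * S + 1 := by omega
  have h := hC β b hb1 hTV S h2S t ht
  rw [div_mul_eq_mul_div]
  exact h

/-- The repaired crux trivially gives its B-free core (`B = 1`). [folklore] -/
theorem someScaleSC_of_cruxSC (h : CompleteAnalyticityAtLargeScalesSC) : CertifiedAtSomeScaleSC := by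
  intro G _ _ _ _ hG hSC
  letI : MeasurableSpace G := borel G
  haveI : BorelSpace G := ⟨rfl⟩
  intro r
  obtain ⟨n, ε, hn, hε, hM, hB⟩ := h G hG hSC r
  obtain ⟨β₂, hβ₂⟩ := hB 1
  refine ⟨n, ε, hn, hε, hM, β₂, fun β hβ => ?_⟩
  obtain ⟨b, -, hb1, hFS⟩ := hβ₂ β hβ
  exact ⟨b, hb1, hFS⟩

/-! ### §4. The same split for the crux AS TYPED, and H against its constructive piece -/

/-- **`CertifiedAtSomeScale`** — line `birth`'s Stub 1 for EVERY compact simple `G` (its registered statement,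
read through `TVFiniteSize`; `Iff.rfl` with `Birth.stub_certifiedAtSomeScale`'s type). [folklore] -/
def CertifiedAtSomeScale : Prop :=
  ∀ (G : Type) [Group G] [TopologicalSpace G] [IsTopologicalGroup G] [CompactSpace G],
    IsCompactSimpleLieGroup G →
    letI : MeasurableSpace G := borel G; haveI : BorelSpace G := ⟨rfl⟩;
    ∀ r : LatticeRep G, ∃ (n : ℕ) (ε : ℝ), 1 ≤ n ∧ 0 ≤ ε ∧
      ε * ((((4 * n + 3) ^ 4 - (4 * n + 1) ^ 4 : ℕ)) : ℝ) < 1 ∧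
      ∃ β₁ : ℝ, ∀ β : ℝ, β₁ ≤ β → ∃ b : ℕ, 1 ≤ b ∧ TVFiniteSize r.ρ β b n ε

/-- **`CertifiedAtSomeScale → ScaleMonotonicity → (A)`** (sorry-free): the alternative two-stub cut of the crux as
typed (monotonicity in place of line `birth`'s Stub 2 `NoCertificateAtBoundedScale`). [folklore] -/
theorem crux_of_someScale_of_monotone (h₁ : CertifiedAtSomeScale) (h₂ : ScaleMonotonicity) :
    Summit.QuantumFields.YangMills.Theses.CertificationLength.CompleteAnalyticityAtLargeScales := by
  intro G _ _ _ _ hG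
  letI : MeasurableSpace G := borel G
  haveI : BorelSpace G := ⟨rfl⟩
  intro r
  obtain ⟨n, ε, hn, hε, hM, β₁, hcert⟩ := h₁ G hG r
  obtain ⟨n', ε', hn', hε', hM', hmono⟩ := h₂ n ε hn hε hM
  refine ⟨n', ε', hn', hε', hM', fun B => ⟨β₁, fun β hβ => ?_⟩⟩
  obtain ⟨b, hb1, hFS⟩ := hcert β hβ
  obtain ⟨b₀, hb₀⟩ := hmono G r.N r.ρ r.continuous r.injective β b hb1 hFS
  refine ⟨max b₀ (max B 1), le_trans (le_max_left _ _) (le_max_right _ _),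
    le_trans (le_max_right _ _) (le_max_right _ _), hb₀ _ (le_max_left _ _)⟩

/-- **H refutes `CertifiedAtSomeScale`** (line `birth`'s Stub 1): H supplies a separating datum at EVERY `b ≥ 1`
beyond `β₀(n)`, so not even one scale is certified on the `π₁ ≠ 0` sector.  Consequently every cut of the crux as
typed that keeps the `π₁ ≠ 0` sector inside a constructive piece (both registered cuts do) has a physics-false stub;
the honest object is `CertifiedAtSomeScaleSC`. [folklore] -/
theorem not_certifiedAtSomeScale_of_forcedDefectSeparation (h : ForcedDefectSeparation) :
    ¬ CertifiedAtSomeScale := by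
  intro hA
  obtain ⟨G, _, _, _, _, hG, -, hsep⟩ := h
  letI : MeasurableSpace G := borel G
  haveI : BorelSpace G := ⟨rfl⟩
  obtain ⟨r, hr⟩ := hsep
  obtain ⟨n, ε, hn, hε, hM, β₁, hcert⟩ := hA G hG r
  obtain ⟨β₀, hβ₀⟩ := hr n hn
  obtain ⟨b, hb1, hFS⟩ := hcert (max β₀ β₁) (le_max_right _ _)
  exact not_tvFiniteSize_of_separatingData r.ρ (max β₀ β₁) b n (eps_lt_half hε hM)
    (hβ₀ (max β₀ β₁) (le_max_left _ _) b hb1) hFS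

/-- The crux as typed gives `CertifiedAtSomeScale` (`B = 1`), closing the square
`(A) → CertifiedAtSomeScale`, `H → ¬ CertifiedAtSomeScale → ¬ (A)`. [folklore] -/
theorem someScale_of_crux
    (h : Summit.QuantumFields.YangMills.Theses.CertificationLength.CompleteAnalyticityAtLargeScales) :
    CertifiedAtSomeScale := by
  intro G _ _ _ _ hG
  letI : MeasurableSpace G := borel G
  haveI : BorelSpace G := ⟨rfl⟩
  intro r
  obtain ⟨n, ε, hn, hε, hM, hB⟩ := h G hG r
  obtain ⟨β₂, hβ₂⟩ := hB 1
  refine ⟨n, ε, hn, hε, hM, β₂, fun β hβ => ?_⟩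
  obtain ⟨b, -, hb1, hFS⟩ := hβ₂ β hβ
  exact ⟨b, hb1, hFS⟩

end Summit.QuantumFields.YangMills.Cruxes.CompleteAnalyticityAtLargeScales.Strategist

end
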